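import Mathlib
import Summits.ValiantsHypothesis.ValiantsHypothesis.Theorems.LacunarySymmetroidMatrixDescartesGramDualOrthogonalLetters

/-!
# `MatrixDescartes` (stmt-ValiantsHypothesis-18050) — Gram duality, part 13: the ORTHOGONAL-LETTERS LAW in PIVOT
# currency (`X^e J + Σ_k X^{d_k} S_k`, `κ`-indexed letters): `Z₊ ≤ Σ_k Z₊(X^eJ + X^{d_k}S_k) ≤ card κ · m`

HONEST FRAMING.  Cell `pub-symmetroid`, seat `val-sym-mdr-p2` (gen 19); helper file `--supports` the crux
`Theses.LacunarySymmetroid.MatrixDescartes` (OPEN), NO closure claim; companion of `…GramDualOrthogonalLetters`.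
The same sector law in the PIVOT currency used by the line `Lift` and by the pivot-column files of this cell
(`X^e • J + Σ_k X^{d_k} • S_k`, `κ` any finite letter type, `J` the pivot): nothing here bears on the crux in its
window, `stub_twoSided`, `DoorA26` / `DoorA34`, registers, or `VP ≠ VNP`.

* **`card_posRoots_pivot_orthogonalLetters_split_le` (ADDITIVITY).**  `det J ≠ 0` (any signature; `J` need not be
  symmetric), real symmetric letters `S_k` (ANY signs — PSD not needed) with pairwise `J⁻¹`-ORTHOGONAL ranges
  (`S_k J⁻¹ S_l = 0`, `k ≠ l`), arbitrary exponents on both sides of `e`: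
  `Z₊(X^eJ + Σ_k X^{d_k}S_k) ≤ Σ_k Z₊(X^eJ + X^{d_k}S_k)`.
* **`card_posRoots_pivot_orthogonalLetters_le` (`Z₊ ≤ K·m`).**  Same hypotheses ⇒ `Z₊ ≤ card κ · m`.
* `card_posRoots_pivot_oneLetter_le` — one symmetric letter against a non-degenerate pivot: `Z₊ ≤ m`.
Consequence for the cell's located questions: an NSD-pivot (or any-pivot) word exceeding `K·m` positive zeros must
have letters whose ranges INTERACT through `J⁻¹` (are not pairwise `J⁻¹`-orthogonal).

[folklore] (spectral theorem + Sylvester + block determinants).  Axioms `propext`, `Classical.choice`, `Quot.sound`.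
-/

-- layout Summits/ValiantsHypothesis/ValiantsHypothesis forces the duplicated namespace component
set_option linter.dupNamespace false

namespace Summit.ValiantsHypothesis.ValiantsHypothesis.Theorems.LacunarySymmetroidMatrixDescartes

open Polynomial Matrix Finset
open scoped BigOperators

namespace GramDual

variable {m : ℕ} {κ : Type*} [Fintype κ] [DecidableEq κ]

/-- the signed column part (file-local notation, as in `…GramDualSigned`) -/
local notation3 (prettyPrint := false) "𝕊[" U ", " σ ", " δ "]" =>
  ((U : Matrix _ _ ℝ).map Polynomial.C
      * Matrix.diagonal (fun j => Polynomial.C ((σ : _ → ℝ) j) * (Polynomial.X : Polynomial ℝ) ^ (δ j : ℕ))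
      * ((U : Matrix _ _ ℝ).map Polynomial.C)ᵀ)

/-- the signed primal word (file-local notation, as in `…GramDualSigned`) -/
local notation3 (prettyPrint := false) "𝔽ₛ[" e ", " B ", " U ", " σ ", " δ "]" =>
  (((Polynomial.X : Polynomial ℝ) ^ (e : ℕ)) • (B : Matrix _ _ ℝ).map Polynomial.C + 𝕊[U, σ, δ])

/-- padded column matrix of a diagonalisation datum (file-local notation, as in `…GramDualOrthogonalLetters`) -/
local notation3 (prettyPrint := false) "Upad[" P ", " lam "]" =>
  (Matrix.of fun (a i : Fin _) => if (lam : Fin _ → ℝ) i ≠ 0 then (P : Matrix _ _ ℝ) a i else (0 : ℝ))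

/-- padded signs (file-local notation, as in `…GramDualOrthogonalLetters`) -/
local notation3 (prettyPrint := false) "σpad[" lam "]" =>
  (fun i : Fin _ => if (lam : Fin _ → ℝ) i ≠ 0 then (lam : Fin _ → ℝ) i else (1 : ℝ))

/-- **ADDITIVITY IN PIVOT CURRENCY.**  `det J ≠ 0`; real symmetric letters with pairwise `J⁻¹`-orthogonal ranges
(`S_k J⁻¹ S_l = 0`, `k ≠ l`): `Z₊(X^eJ + Σ_k X^{d_k}S_k) ≤ Σ_k Z₊(X^eJ + X^{d_k}S_k)`. [folklore] -/
theorem card_posRoots_pivot_orthogonalLetters_split_le (e : ℕ) (d : κ → ℕ) (J : Matrix (Fin m) (Fin m) ℝ)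
    (hJ : IsUnit J.det) (S : κ → Matrix (Fin m) (Fin m) ℝ) (hS : ∀ k, (S k).IsSymm)
    (horth : ∀ k l, k ≠ l → S k * J⁻¹ * S l = 0) :
    ((Matrix.det (((Polynomial.X : Polynomial ℝ) ^ e) • J.map Polynomial.C
        + ∑ k, ((Polynomial.X : Polynomial ℝ) ^ d k) • (S k).map Polynomial.C)).roots.toFinset.filter
        (fun t => 0 < t)).card
      ≤ ∑ k, ((Matrix.det (((Polynomial.X : Polynomial ℝ) ^ e) • J.map Polynomial.C
            + ((Polynomial.X : Polynomial ℝ) ^ d k) • (S k).map Polynomial.C)).roots.toFinset.filter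
            (fun t => 0 < t)).card := by
  classical
  choose P lam hP hfac using fun k => exists_diag_datum (hS k)
  have hk : ∀ k, ((Polynomial.X : Polynomial ℝ) ^ d k) • (S k).map Polynomial.C
      = 𝕊[Upad[P k, lam k], σpad[lam k], (fun _ : Fin m => d k)] := fun k => padded_letter_eq (hfac k) (d k)
  simp only [hk]
  exact card_posRoots_family_le J hJ (fun k => Upad[P k, lam k]) (fun k => σpad[lam k])
    (fun k i => sigmaPad_ne_zero (lam k) i) e (fun k _ => d k)
    (fun k l hkl => padded_gram_eq_zero (hfac k) (hP k) (hfac l) (hP l) J (horth k l hkl))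

/-- **`Z₊ ≤ K·m` IN PIVOT CURRENCY.**  `det J ≠ 0`; real symmetric letters with pairwise `J⁻¹`-orthogonal ranges:
`Z₊(X^eJ + Σ_k X^{d_k}S_k) ≤ card κ · m`, all exponents, any signs of the letters. [folklore] -/
theorem card_posRoots_pivot_orthogonalLetters_le (e : ℕ) (d : κ → ℕ) (J : Matrix (Fin m) (Fin m) ℝ)
    (hJ : IsUnit J.det) (S : κ → Matrix (Fin m) (Fin m) ℝ) (hS : ∀ k, (S k).IsSymm)
    (horth : ∀ k l, k ≠ l → S k * J⁻¹ * S l = 0) :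
    ((Matrix.det (((Polynomial.X : Polynomial ℝ) ^ e) • J.map Polynomial.C
        + ∑ k, ((Polynomial.X : Polynomial ℝ) ^ d k) • (S k).map Polynomial.C)).roots.toFinset.filter
        (fun t => 0 < t)).card ≤ Fintype.card κ * m := by
  classical
  choose P lam hP hfac using fun k => exists_diag_datum (hS k)
  have hk : ∀ k, ((Polynomial.X : Polynomial ℝ) ^ d k) • (S k).map Polynomial.C
      = 𝕊[Upad[P k, lam k], σpad[lam k], (fun _ : Fin m => d k)] := fun k => padded_letter_eq (hfac k) (d k)
  simp only [hk]
  have h := card_posRoots_orthogonalLetters_le J hJ (fun k => Upad[P k, lam k]) (fun k => σpad[lam k])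
    (fun k i => sigmaPad_ne_zero (lam k) i) e d
    (fun k l hkl => padded_gram_eq_zero (hfac k) (hP k) (hfac l) (hP l) J (horth k l hkl))
  rw [Fintype.card_fin] at h
  exact h

/-- **One symmetric letter against a non-degenerate pivot**: `Z₊(X^eJ + X^dS) ≤ m`. [folklore] -/
theorem card_posRoots_pivot_oneLetter_le (e d : ℕ) (J : Matrix (Fin m) (Fin m) ℝ) (hJ : IsUnit J.det)
    (S : Matrix (Fin m) (Fin m) ℝ) (hS : S.IsSymm) :
    ((Matrix.det (((Polynomial.X : Polynomial ℝ) ^ e) • J.map Polynomial.C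
        + ((Polynomial.X : Polynomial ℝ) ^ d) • S.map Polynomial.C)).roots.toFinset.filter (fun t => 0 < t)).card
      ≤ m := by
  obtain ⟨P, lam, hP, hfac⟩ := exists_diag_datum hS
  rw [padded_letter_eq hfac d]
  have h := card_posRoots_oneLetter_le J hJ (Upad[P, lam]) (σpad[lam]) (fun i => sigmaPad_ne_zero lam i) e d
  rw [Fintype.card_fin] at h
  exact h

end GramDual

end Summit.ValiantsHypothesis.ValiantsHypothesis.Theorems.LacunarySymmetroidMatrixDescartes
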